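import Literature.Combinatorics.StablePolynomials.RealStabilityPreservers
import HarnessLib

/-!
# Real stability preservers on multi-affine polynomials (Borcea–Brändén I, Theorem 1.2, case `κ = (1,…,1)`), II:
# necessity and the characterisation

J. Borcea, P. Brändén, *The Lee–Yang and Pólya–Schur programs. I. Linear operators preserving stability*,
Invent. Math. 177 (2009) 541–569 (arXiv:0809.0401), §1.1 Theorem 1.2 and §4 (proof of Theorem 1.2).

> **Theorem 1.2.** Let `κ ∈ ℕⁿ` and `T : ℝ_κ[z_1,…,z_n] → ℝ[z_1,…,z_n]` be a linear operator. Then `T`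
> preserves real stability if and only if either
> (a) `T` has range of dimension no greater than two and is of the form `T(f) = α(f)P + β(f)Q`, where
> `α, β : ℝ_κ[z_1,…,z_n] → ℝ` are linear functionals and `P, Q` are real stable polynomials such that
> `P ≪ Q`, or
> (b) `G_T(z,w) ∈ 𝓗_{2n}(ℝ)`, or
> (c) `G_T(z,-w) ∈ 𝓗_{2n}(ℝ)`.

This file proves the "only if" direction for `κ = (1,…,1)` (multi-affine polynomials, variables indexed by a
finite type `σ`) and assembles the characterisation `multiAffine_realStabilityPreserver_iff`; the "if"
direction, the real symbol `realMultiAffineSymbol T = G_T(z,w)`, its sign-twisted form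
`negInr (realMultiAffineSymbol T) = G_T(z,-w)` and the decomposition `(z+W)^{[n]} = F_W + iG_W`
(`reProdXAddC W`, `imProdXAddC W`) with `G_T(·,W) = T(F_W) + iT(G_W)` (`symbolAt_eq`) are in
`RealStabilityPreservers.lean`. "Preserves real stability" is read, as everywhere in this directory, as
`T(𝓗(ℝ) ∩ MA) ⊆ 𝓗(ℝ) ∪ {0}`.

## The printed proof (§4) and its formalisation

Fix `W ∈ ℋⁿ` and write `(z+W)^{[n]} = F + iG`. Since `(z+W)^{[n]}` is stable, `G ≪ F`
(`isProperPosition_imProdXAddC_reProdXAddC`); by the multivariate Hermite–Kakeya–Obreschkoff theorem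
(Thm. 1.9, tree `IsProperPosition.pencil` / `isRealStable_pencil_iff`) every `αF + βG` is real stable or
zero, hence so is every `αT(F) + βT(G)`, and by Thm. 1.9 again (`apply_trichotomy`)

  `T(F) + iT(G) = G_T(z,W) ∈ 𝓗_n(ℂ) ∪ 𝓗_n^-(ℂ) ∪ {0}`,

the three cases being `T(G) ≪ T(F)`, `T(F) ≪ T(G)` and `T(F) = T(G) = 0`.

* If `G_T(·,W) ∈ 𝓗_n(ℂ)` for all `W ∈ ℋⁿ` then `G_T(z,w) ∈ 𝓗_{2n}(ℝ)`
  (`isRealStable_realMultiAffineSymbol_of_forall`, via `eval_map_realMultiAffineSymbol`).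
* If `G_T(·,W) ∈ 𝓗_n^-(ℂ)` for all `W ∈ ℋⁿ` then `G_T(z,-w) ∈ 𝓗_{2n}(ℝ)`
  (`isRealStable_negInr_realMultiAffineSymbol_of_forall`): the printed "`T[(z-W)^κ] ∈ 𝓗_n(ℂ)` for all `W`"
  is obtained from the identity `i·G_T(·, conj V) = T(G_V) + iT(F_V)` (`C_I_mul_symbolAt_conj`) at
  `V = -conj W ∈ ℋⁿ`.
* Otherwise there are `W₁, W₂ ∈ ℋⁿ` with `G_T(·,W₁) ∈ 𝓗_n^-(ℂ) ∪ {0}` and `G_T(·,W₂) ∈ 𝓗_n(ℂ) ∪ {0}`, and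
  "by a homotopy argument" some `W' = (1-t)W₁ + tW₂` has `G_T(·,W') ∈ (𝓗_n(ℂ) ∩ 𝓗_n^-(ℂ)) ∪ {0}`
  (`exists_degenerate`). The homotopy argument is made precise with the half-plane form of the
  Hermite–Biehler theorem (Lemma 1.8, tree `isProperPosition_iff`): along the segment the two memberships
  are the closed conditions `Im (T(F_t)(z) · conj T(G_t)(z)) ≤ 0 on ℋⁿ`, resp. with `F, G` exchanged
  (`isClosed_setOf_im_eval_mul_conj_nonpos`, `exists_mem_Icc_of_cover`), and `[0,1]` is connected.
  At such a `W'`, Proposition 4.1 / Corollary 1.10 (tree `IsProperPosition.exists_eq_C_mul`) gives real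
  `a, b`, not both zero, with `T(bF' - aG') = 0` (`exists_pair_of_degenerate`); Lemma 3.1
  (tree `exists_isUpperHalfPlaneStable_prod_add_C_mul`) then shows, exactly as printed
  (`bf - ag + ε'h + i(af + bg) ∈ 𝓗_n(ℂ)`), that `T(h) ∈ 𝓗_n(ℝ) ∪ {0}` for every multi-affine real `h`
  (`apply_eq_zero_or_isRealStable_of_pair`), and Lemma 3.2 (i) (tree `not_linearIndependent_of_forall_mem`)
  together with Thm. 1.9 (tree `isProperPosition_or_of_forall_mem`) yields the rank-two form (a) with
  `P ≪ Q` (`exists_rankTwo_of_forall_apply`; the functionals `α, β` are coordinate maps obtained from a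
  left inverse of `(a,b) ↦ aP + bQ`).

## Contents

* §1 `isProperPosition_imProdXAddC_reProdXAddC`, `apply_trichotomy` — the pointwise trichotomy.
* §2 `exists_pair_of_degenerate`, `apply_eq_zero_or_isRealStable_of_pair`, `realMultiAffineSubmodule`,
  `exists_rankTwo_of_forall_apply` — the degenerate case gives (a).
* §3 `isRealStable_realMultiAffineSymbol_of_forall`, `C_I_mul_symbolAt_conj`,
  `isRealStable_negInr_realMultiAffineSymbol_of_forall` — the two symbol cases (b), (c).
* §4 `eval_map_apply_reProdXAddC`, `eval_map_apply_imProdXAddC`, `exists_degenerate` — the homotopy.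
* §5 **`multiAffine_realStabilityPreserver_necessity`**, **`multiAffine_realStabilityPreserver_iff`** —
  Theorem 1.2 for `κ = (1,…,1)`.

## References

* [BorceaBranden2009] J. Borcea, P. Brändén, Invent. Math. 177 (2009) 541–569, §1.1 Thm. 1.2, §1.2
  Thm. 1.6, Lemma 1.8, Thm. 1.9, Cor. 1.10, §3 Lemmas 3.1, 3.2, §4 Prop. 4.1 and the proof of Thm. 1.2.
-/

noncomputable section

open MvPolynomial Finset
open scoped ComplexConjugate

namespace Literature.Combinatorics.StablePolynomials

variable {σ : Type*}

/-! ## §1 The pointwise trichotomy `G_T(·,W) ∈ 𝓗_n(ℂ) ∪ 𝓗_n^-(ℂ) ∪ {0}` -/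

section Trichotomy

variable [Fintype σ] [DecidableEq σ]

/-- **`G_W ≪ F_W`** for `W ∈ ℋⁿ`: `F_W + iG_W = (z+W)^{[n]}` is stable. [cite: BorceaBranden2009, §4 proof of
Thm. 1.2 ("Write `(z+W)^κ ∈ 𝓗_n(ℂ)` as `F(z) + iG(z)`")] -/
theorem isProperPosition_imProdXAddC_reProdXAddC {W : σ → ℂ} (hW : ∀ i, 0 < (W i).im) :
    IsProperPosition (imProdXAddC W) (reProdXAddC W) := by
  rw [IsProperPosition, map_reProdXAddC_add]
  exact isUpperHalfPlaneStable_prod_X_add_C hW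

/-- `F_W` is real stable or zero (`W ∈ ℋⁿ`). [cite: BorceaBranden2009, §4 proof of Thm. 1.2 ("by Theorem 1.9,
`αF + βG ∈ 𝓗_n(ℝ) ∪ {0}` for all `α, β ∈ ℝ`")] -/
theorem reProdXAddC_eq_zero_or_isRealStable {W : σ → ℂ} (hW : ∀ i, 0 < (W i).im) :
    reProdXAddC W = 0 ∨ IsRealStable (reProdXAddC W) :=
  (isProperPosition_imProdXAddC_reProdXAddC hW).eq_zero_or_isRealStable_right

/-- `G_W` is real stable or zero (`W ∈ ℋⁿ`). [cite: BorceaBranden2009, §4 proof of Thm. 1.2 ("by Theorem 1.9,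
`αF + βG ∈ 𝓗_n(ℝ) ∪ {0}` for all `α, β ∈ ℝ`")] -/
theorem imProdXAddC_eq_zero_or_isRealStable {W : σ → ℂ} (hW : ∀ i, 0 < (W i).im) :
    imProdXAddC W = 0 ∨ IsRealStable (imProdXAddC W) :=
  (isProperPosition_imProdXAddC_reProdXAddC hW).eq_zero_or_isRealStable_left

variable (T : MvPolynomial σ ℝ →ₗ[ℝ] MvPolynomial σ ℝ)

/-- For a real stability preserver, `T(F_W) ∈ 𝓗_n(ℝ) ∪ {0}`. [cite: BorceaBranden2009, §4 proof of Thm. 1.2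
("hence `αT(F) + βT(G) ∈ 𝓗_n(ℝ) ∪ {0}`")] -/
theorem apply_reProdXAddC_eq_zero_or_isRealStable
    (hT : ∀ f : MvPolynomial σ ℝ, IsMultiAffine f → IsRealStable f → IsRealStable (T f) ∨ T f = 0)
    {W : σ → ℂ} (hW : ∀ i, 0 < (W i).im) :
    T (reProdXAddC W) = 0 ∨ IsRealStable (T (reProdXAddC W)) := by
  rcases reProdXAddC_eq_zero_or_isRealStable hW with h | h
  · exact Or.inl (by rw [h, map_zero])
  · exact (hT _ (isMultiAffine_reProdXAddC W) h).symm

/-- For a real stability preserver, `T(G_W) ∈ 𝓗_n(ℝ) ∪ {0}`. [cite: BorceaBranden2009, §4 proof of Thm. 1.2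
("hence `αT(F) + βT(G) ∈ 𝓗_n(ℝ) ∪ {0}`")] -/
theorem apply_imProdXAddC_eq_zero_or_isRealStable
    (hT : ∀ f : MvPolynomial σ ℝ, IsMultiAffine f → IsRealStable f → IsRealStable (T f) ∨ T f = 0)
    {W : σ → ℂ} (hW : ∀ i, 0 < (W i).im) :
    T (imProdXAddC W) = 0 ∨ IsRealStable (T (imProdXAddC W)) := by
  rcases imProdXAddC_eq_zero_or_isRealStable hW with h | h
  · exact Or.inl (by rw [h, map_zero])
  · exact (hT _ (isMultiAffine_imProdXAddC W) h).symm

/-- **The trichotomy** `G_T(z,W) = T(F) + iT(G) ∈ 𝓗_n(ℂ) ∪ 𝓗_n^-(ℂ) ∪ {0}` for `W ∈ ℋⁿ` and a real stability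
preserver `T`, in the form: `T(F) = T(G) = 0`, or `T(G) ≪ T(F)`, or `T(F) ≪ T(G)` — two applications of the
Hermite–Kakeya–Obreschkoff theorem (Thm. 1.9). [cite: BorceaBranden2009, §4 proof of Thm. 1.2 ("By Theorem 1.9
again this means that `T(F) + iT(G) = G_T(z,W) ∈ 𝓗_n(ℂ) ∪ 𝓗_n^-(ℂ) ∪ {0}`")] -/
theorem apply_trichotomy
    (hT : ∀ f : MvPolynomial σ ℝ, IsMultiAffine f → IsRealStable f → IsRealStable (T f) ∨ T f = 0)
    {W : σ → ℂ} (hW : ∀ i, 0 < (W i).im) :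
    (T (imProdXAddC W) = 0 ∧ T (reProdXAddC W) = 0) ∨
      IsProperPosition (T (imProdXAddC W)) (T (reProdXAddC W)) ∨
        IsProperPosition (T (reProdXAddC W)) (T (imProdXAddC W)) := by
  refine (isRealStable_pencil_iff _ _).1 fun a b => ?_
  have hq : C a * T (imProdXAddC W) + C b * T (reProdXAddC W) =
      T (a • imProdXAddC W + b • reProdXAddC W) := by
    rw [map_add, map_smul, map_smul, smul_eq_C_mul, smul_eq_C_mul]
  rw [hq]
  rcases (isProperPosition_imProdXAddC_reProdXAddC hW).pencil a b with h0 | hs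
  · rw [← smul_eq_C_mul, ← smul_eq_C_mul] at h0
    exact Or.inl (by rw [h0, map_zero])
  · rw [← smul_eq_C_mul, ← smul_eq_C_mul] at hs
    exact (hT _ (((isMultiAffine_imProdXAddC W).smul a).add ((isMultiAffine_reProdXAddC W).smul b)) hs).symm

end Trichotomy

/-! ## §2 The degenerate case `G_T(·,W) ∈ (𝓗_n(ℂ) ∩ 𝓗_n^-(ℂ)) ∪ {0}` gives (a) -/

section Degenerate

variable [Fintype σ] [DecidableEq σ] (T : MvPolynomial σ ℝ →ₗ[ℝ] MvPolynomial σ ℝ)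

/-- **`T(bF - aG) = 0`.** If `G_T(·,W) = T(F) + iT(G)` is zero or lies in `𝓗_n(ℂ) ∩ 𝓗_n^-(ℂ)` (i.e.
`T(G) ≪ T(F)` and `T(F) ≪ T(G)`), then by Proposition 4.1 / Corollary 1.10 there are real `a, b`, not both
zero, with `T(F) = ap`, `T(G) = bp`, so that `T(bF - aG) = 0`. [cite: BorceaBranden2009, §4 proof of
Thm. 1.2 ("by Proposition 4.1 there is a real stable polynomial `p` and `a, b ∈ ℝ` such that
`G_T(z,W') = (a+bi)p(z)` … Then `T(f) = ap` and `T(g) = bp` so that `T(bf - ag) = 0`")] -/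
theorem exists_pair_of_degenerate {W : σ → ℂ}
    (hd : symbolAt T W = 0 ∨
      (IsProperPosition (T (imProdXAddC W)) (T (reProdXAddC W)) ∧
        IsProperPosition (T (reProdXAddC W)) (T (imProdXAddC W)))) :
    ∃ a b : ℝ, (a ≠ 0 ∨ b ≠ 0) ∧ T (C b * reProdXAddC W + C (-a) * imProdXAddC W) = 0 := by
  rcases hd with h0 | ⟨hvu, huv⟩
  · rw [symbolAt_eq_zero_iff] at h0
    refine ⟨0, 1, Or.inr one_ne_zero, ?_⟩
    rw [neg_zero, C_0, zero_mul, add_zero, C_1, one_mul, h0.2]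
  · by_cases hu : T (reProdXAddC W) = 0
    · refine ⟨0, 1, Or.inr one_ne_zero, ?_⟩
      rw [neg_zero, C_0, zero_mul, add_zero, C_1, one_mul, hu]
    · obtain ⟨c, hc⟩ := hvu.exists_eq_C_mul huv hu
      refine ⟨1, c, Or.inl one_ne_zero, ?_⟩
      rw [map_add, ← smul_eq_C_mul, ← smul_eq_C_mul, map_smul, map_smul, hc, neg_one_smul, smul_eq_C_mul,
        add_neg_cancel]

/-- **Every `T(h)`, `h` multi-affine, is real stable or zero** once `T(bF_W - aG_W) = 0` for some `W ∈ ℋⁿ` and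
real `(a,b) ≠ (0,0)`: with `c = b + ia`, Lemma 3.1 applied to `c⁻¹h` gives `ε > 0` with
`c·((z+W)^{[n]} + εc⁻¹h) = (bF - aG + εh) + i(aF + bG) ∈ 𝓗_n(ℂ)`, so `aF + bG ≪ bF - aG + εh`, the latter is
real stable or zero (Thm. 1.9 / Lemma 1.8), and `T(h) = ε⁻¹ T(bF - aG + εh) ∈ 𝓗_n(ℝ) ∪ {0}`.
[cite: BorceaBranden2009, §4 proof of Thm. 1.2 ("`|bf - ag + ε'h + i(af+bg)| > 0` … so by Theorem 1.9 we have
`bf - ag + ε'h ∈ 𝓗_n(ℝ) ∪ {0}`. It follows that `T(h) = (1/ε')T(bf - ag + ε'h) ∈ 𝓗_n(ℝ) ∪ {0}`")] -/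
theorem apply_eq_zero_or_isRealStable_of_pair
    (hT : ∀ f : MvPolynomial σ ℝ, IsMultiAffine f → IsRealStable f → IsRealStable (T f) ∨ T f = 0)
    {W : σ → ℂ} (hW : ∀ i, 0 < (W i).im) {a b : ℝ} (hab : a ≠ 0 ∨ b ≠ 0)
    (h0 : T (C b * reProdXAddC W + C (-a) * imProdXAddC W) = 0)
    {h : MvPolynomial σ ℝ} (hh : IsMultiAffine h) : T h = 0 ∨ IsRealStable (T h) := by
  set c : ℂ := (b : ℂ) + (a : ℂ) * Complex.I with hc_def
  have hc : c ≠ 0 := by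
    intro hc0
    have hre := congrArg Complex.re hc0
    have him := congrArg Complex.im hc0
    simp only [hc_def, Complex.add_re, Complex.ofReal_re, Complex.mul_re, Complex.I_re, mul_zero,
      Complex.ofReal_im, Complex.I_im, sub_zero, add_zero, Complex.zero_re, Complex.add_im,
      Complex.mul_im, mul_one, zero_add, Complex.zero_im] at hre him
    exact hab.elim (fun ha => ha him) fun hb => hb hre
  have hma : IsMultiAffine (C c⁻¹ * map (algebraMap ℝ ℂ) h) := by
    rw [← smul_eq_C_mul]
    exact (isMultiAffine_map_algebraMap hh).smul _
  obtain ⟨ε, hε, hst⟩ := exists_isUpperHalfPlaneStable_prod_add_C_mul hma hW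
  have hst' := (isUpperHalfPlaneStable_C hc).mul hst
  have hI : (C Complex.I : MvPolynomial σ ℂ) * C Complex.I = -1 := by
    rw [← map_mul, Complex.I_mul_I, map_neg, map_one]
  have hCc : (C c : MvPolynomial σ ℂ) = C (b : ℂ) + C (a : ℂ) * C Complex.I := by
    rw [hc_def, map_add, map_mul]
  have hcc : (C (b : ℂ) + C (a : ℂ) * C Complex.I : MvPolynomial σ ℂ) * C c⁻¹ = 1 := by
    rw [← hCc, ← map_mul, mul_inv_cancel₀ hc, map_one]
  have key : C c * (∏ i, (X i + C (W i)) + C (ε : ℂ) * (C c⁻¹ * map (algebraMap ℝ ℂ) h)) =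
      map (algebraMap ℝ ℂ) (C b * reProdXAddC W + C (-a) * imProdXAddC W + C ε * h) +
        C Complex.I * map (algebraMap ℝ ℂ) (C a * reProdXAddC W + C b * imProdXAddC W) := by
    rw [← map_reProdXAddC_add, hCc]
    simp only [map_add, map_mul, map_neg, map_C, Complex.coe_algebraMap]
    linear_combination (C (a : ℂ) * map (algebraMap ℝ ℂ) (imProdXAddC W)) * hI +
      (C (ε : ℂ) * map (algebraMap ℝ ℂ) h) * hcc
  rw [key] at hst'
  have hpp : IsProperPosition (C a * reProdXAddC W + C b * imProdXAddC W)
      (C b * reProdXAddC W + C (-a) * imProdXAddC W + C ε * h) := hst'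
  have hTg : T (C b * reProdXAddC W + C (-a) * imProdXAddC W + C ε * h) = ε • T h := by
    rw [map_add, h0, zero_add, ← smul_eq_C_mul, map_smul]
  rcases hpp.eq_zero_or_isRealStable_right with hg0 | hgs
  · have h1 : ε • T h = 0 := by rw [← hTg, hg0, map_zero]
    exact Or.inl ((smul_eq_zero.1 h1).resolve_left hε.ne')
  · have hmag : IsMultiAffine (C b * reProdXAddC W + C (-a) * imProdXAddC W + C ε * h) := by
      rw [← smul_eq_C_mul, ← smul_eq_C_mul, ← smul_eq_C_mul]
      exact (((isMultiAffine_reProdXAddC W).smul b).add ((isMultiAffine_imProdXAddC W).smul (-a))).add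
        (hh.smul ε)
    rcases hT _ hmag hgs with hs | hz
    · rw [hTg, smul_eq_C_mul] at hs
      exact Or.inr ((isRealStable_C_mul_iff hε.ne' _).1 hs)
    · rw [hTg] at hz
      exact Or.inl ((smul_eq_zero.1 hz).resolve_left hε.ne')

omit [Fintype σ] [DecidableEq σ] in
/-- `1` is real stable. [cite: BorceaBranden2009, §1 (definition of `𝓗_n(ℝ)`: nonzero constants have no
zeros)] -/
theorem isRealStable_one : IsRealStable (1 : MvPolynomial σ ℝ) := by
  intro z _
  rw [map_one, map_one]
  exact one_ne_zero

omit [Fintype σ] [DecidableEq σ] in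
/-- `P ≪ P` for real stable `P`: `P + iP = (1+i)P`. [cite: BorceaBranden2009, §1.2 Definition of `≪`
(before Thm. 1.6)] -/
theorem IsRealStable.isProperPosition_self {P : MvPolynomial σ ℝ} (hP : IsRealStable P) :
    IsProperPosition P P := by
  intro z hz
  rw [map_add, map_mul, eval_C, ← one_add_mul]
  exact mul_ne_zero (fun h => by simpa using congrArg Complex.re h) (hP z hz)

omit [Fintype σ] [DecidableEq σ] in
/-- **The space `ℝ_{(1,…,1)}[z_σ]`** of real multi-affine polynomials, as a submodule of `ℝ[z_σ]`.
[cite: BorceaBranden2009, §1.1 (the space `𝕂_κ[z_1,…,z_n]`, `κ = (1,…,1)`)] -/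
def realMultiAffineSubmodule (σ : Type*) : Submodule ℝ (MvPolynomial σ ℝ) where
  carrier := {f | IsMultiAffine f}
  add_mem' hf hg := hf.add hg
  zero_mem' := isMultiAffine_zero
  smul_mem' c _ hf := hf.smul c

omit [Fintype σ] [DecidableEq σ] in
/-- Membership in `ℝ_{(1,…,1)}[z_σ]`. [cite: BorceaBranden2009, §1.1 (the space `𝕂_κ[z_1,…,z_n]`)] -/
theorem mem_realMultiAffineSubmodule {f : MvPolynomial σ ℝ} :
    f ∈ realMultiAffineSubmodule σ ↔ IsMultiAffine f :=
  Iff.rfl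

omit [Fintype σ] [DecidableEq σ] in
/-- Coordinates along one nonzero vector: a linear functional `α` with `α(aP) = a`. [folklore] -/
private theorem exists_functional_singleton {P : MvPolynomial σ ℝ} (hP : P ≠ 0) :
    ∃ α : MvPolynomial σ ℝ →ₗ[ℝ] ℝ, ∀ a : ℝ, α (a • P) = a := by
  obtain ⟨L, hL⟩ := LinearMap.exists_leftInverse_of_injective
    (LinearMap.toSpanSingleton ℝ (MvPolynomial σ ℝ) P) (LinearMap.ker_toSpanSingleton ℝ hP)
  exact ⟨L, fun a => by simpa using LinearMap.congr_fun hL a⟩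

omit [Fintype σ] [DecidableEq σ] in
/-- Coordinates along two independent vectors: linear functionals `α, β` with `α(aP + bQ) = a`,
`β(aP + bQ) = b`. [folklore] -/
private theorem exists_functionals_pair {P Q : MvPolynomial σ ℝ}
    (hPQ : ∀ s t : ℝ, s • P + t • Q = 0 → s = 0 ∧ t = 0) :
    ∃ α β : MvPolynomial σ ℝ →ₗ[ℝ] ℝ, ∀ a b : ℝ, α (a • P + b • Q) = a ∧ β (a • P + b • Q) = b := by
  set ψ : ℝ × ℝ →ₗ[ℝ] MvPolynomial σ ℝ :=
    (LinearMap.toSpanSingleton ℝ _ P).coprod (LinearMap.toSpanSingleton ℝ _ Q) with hψ_def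
  have hψ : ∀ ab : ℝ × ℝ, ψ ab = ab.1 • P + ab.2 • Q := fun ab => by
    simp [hψ_def]
  have hker : LinearMap.ker ψ = ⊥ := LinearMap.ker_eq_bot'.2 fun ab hab => by
    rw [hψ] at hab
    obtain ⟨h1, h2⟩ := hPQ _ _ hab
    exact Prod.ext h1 h2
  obtain ⟨L, hL⟩ := LinearMap.exists_leftInverse_of_injective ψ hker
  refine ⟨(LinearMap.fst ℝ ℝ ℝ).comp L, (LinearMap.snd ℝ ℝ ℝ).comp L, fun a b => ?_⟩
  have hab := LinearMap.congr_fun hL (a, b)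
  rw [LinearMap.comp_apply, hψ, LinearMap.id_apply] at hab
  simp [hab]

omit [DecidableEq σ] in
/-- **The degenerate case yields (a).** If every `T(h)`, `h` multi-affine, is real stable or zero, then the
image of `T` on `ℝ_{(1,…,1)}[z_σ]` has dimension at most two (Lemma 3.2 (i)) and `T(f) = α(f)P + β(f)Q`
with `P, Q` real stable, `P ≪ Q` (any two elements of such a space are comparable, Thm. 1.9).
[cite: BorceaBranden2009, §4 proof of Thm. 1.2 ("all nonzero polynomials in the image of `T` are real stable
and by Lemma 3.2 we conclude that the image of `T` is of dimension at most two") and §3 Lemma 3.2 (i)] -/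
theorem exists_rankTwo_of_forall_apply {T : MvPolynomial σ ℝ →ₗ[ℝ] MvPolynomial σ ℝ}
    (himg : ∀ h : MvPolynomial σ ℝ, IsMultiAffine h → T h = 0 ∨ IsRealStable (T h)) :
    ∃ (α β : MvPolynomial σ ℝ →ₗ[ℝ] ℝ) (P Q : MvPolynomial σ ℝ), IsRealStable P ∧ IsRealStable Q ∧
      IsProperPosition P Q ∧ ∀ f : MvPolynomial σ ℝ, IsMultiAffine f → T f = α f • P + β f • Q := by
  classical
  set V : Submodule ℝ (MvPolynomial σ ℝ) := (realMultiAffineSubmodule σ).map T with hV_def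
  have hmemV : ∀ f : MvPolynomial σ ℝ, IsMultiAffine f → T f ∈ V := fun f hf =>
    Submodule.mem_map_of_mem (mem_realMultiAffineSubmodule.2 hf)
  have hV : ∀ p ∈ V, p = 0 ∨ IsRealStable p := by
    intro p hp
    obtain ⟨f, hf, rfl⟩ := Submodule.mem_map.1 hp
    exact himg f hf
  by_cases hzero : ∀ f : MvPolynomial σ ℝ, IsMultiAffine f → T f = 0
  · refine ⟨0, 0, 1, 1, isRealStable_one, isRealStable_one, isRealStable_one.isProperPosition_self,
      fun f hf => ?_⟩
    rw [hzero f hf, LinearMap.zero_apply, zero_smul, add_zero]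
  push Not at hzero
  obtain ⟨f₀, hf₀, hP0⟩ := hzero
  set P := T f₀ with hP_def
  have hPs : IsRealStable P := (himg f₀ hf₀).resolve_left hP0
  by_cases hone : ∀ f : MvPolynomial σ ℝ, IsMultiAffine f → ∃ a : ℝ, T f = a • P
  · obtain ⟨α, hα⟩ := exists_functional_singleton hP0
    refine ⟨α.comp T, 0, P, P, hPs, hPs, hPs.isProperPosition_self, fun f hf => ?_⟩
    obtain ⟨a, ha⟩ := hone f hf
    rw [LinearMap.comp_apply, ha, hα, LinearMap.zero_apply, zero_smul, add_zero]
  push Not at hone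
  obtain ⟨f₁, hf₁, hQ⟩ := hone
  set Q := T f₁ with hQ_def
  have hQ0 : Q ≠ 0 := fun h => hQ 0 (by rw [h, zero_smul])
  have hQs : IsRealStable Q := (himg f₁ hf₁).resolve_left hQ0
  -- `P, Q` are linearly independent
  have hind : ∀ s t : ℝ, s • P + t • Q = 0 → s = 0 ∧ t = 0 := by
    intro s t hst
    by_cases ht : t = 0
    · rw [ht, zero_smul, add_zero] at hst
      exact ⟨(smul_eq_zero.1 hst).resolve_right hP0, ht⟩
    · exfalso
      refine hQ (-(t⁻¹ * s)) ?_
      have hQ' : Q = t⁻¹ • (t • Q) := by rw [smul_smul, inv_mul_cancel₀ ht, one_smul]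
      rw [hQ', eq_neg_of_add_eq_zero_right hst, smul_neg, smul_smul, neg_smul]
  -- every image lies in `span {P, Q}` (Lemma 3.2 (i))
  have hspan : ∀ f : MvPolynomial σ ℝ, IsMultiAffine f → ∃ a b : ℝ, T f = a • P + b • Q := by
    intro f hf
    by_contra hnot
    push Not at hnot
    have hmem : ∀ i, ![T f, P, Q] i ∈ V := by
      intro i
      fin_cases i
      · exact hmemV _ hf
      · exact hmemV _ hf₀
      · exact hmemV _ hf₁
    refine not_linearIndependent_of_forall_mem hV hmem (Fintype.linearIndependent_iff.2 fun g hg => ?_)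
    have hg' : g 0 • T f + g 1 • P + g 2 • Q = 0 := by simpa [Fin.sum_univ_three] using hg
    have hg0 : g 0 = 0 := by
      by_contra hg0
      refine hnot (-((g 0)⁻¹ * g 1)) (-((g 0)⁻¹ * g 2)) ?_
      have hTf : T f = (g 0)⁻¹ • (g 0 • T f) := by rw [smul_smul, inv_mul_cancel₀ hg0, one_smul]
      have hsum : g 0 • T f = -(g 1 • P + g 2 • Q) :=
        eq_neg_of_add_eq_zero_left (by rw [← add_assoc]; exact hg')
      rw [hTf, hsum, smul_neg, smul_add, smul_smul, smul_smul, neg_add, neg_smul, neg_smul]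
    rw [hg0, zero_smul, zero_add] at hg'
    obtain ⟨h1, h2⟩ := hind _ _ hg'
    intro i
    fin_cases i
    · exact hg0
    · exact h1
    · exact h2
  -- orientation by Theorem 1.9
  rcases isProperPosition_or_of_forall_mem hV (hmemV _ hf₀) (hmemV _ hf₁) with ⟨hP0', -⟩ | hPQ | hQP
  · exact absurd hP0' hP0
  · obtain ⟨α, β, hαβ⟩ := exists_functionals_pair hind
    refine ⟨α.comp T, β.comp T, P, Q, hPs, hQs, hPQ, fun f hf => ?_⟩
    obtain ⟨a, b, hab⟩ := hspan f hf
    rw [LinearMap.comp_apply, LinearMap.comp_apply, hab, (hαβ a b).1, (hαβ a b).2]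
  · have hind' : ∀ s t : ℝ, s • Q + t • P = 0 → s = 0 ∧ t = 0 := fun s t hst =>
      (hind t s (by rwa [add_comm] at hst)).symm
    obtain ⟨α, β, hαβ⟩ := exists_functionals_pair hind'
    refine ⟨α.comp T, β.comp T, Q, P, hQs, hPs, hQP, fun f hf => ?_⟩
    obtain ⟨a, b, hab⟩ := hspan f hf
    rw [LinearMap.comp_apply, LinearMap.comp_apply, hab, add_comm (a • P), (hαβ b a).1, (hαβ b a).2]

end Degenerate

/-! ## §3 The symbol cases (b) and (c) -/

section SymbolCases

variable [Fintype σ] [DecidableEq σ] (T : MvPolynomial σ ℝ →ₗ[ℝ] MvPolynomial σ ℝ)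

/-- **Case (b).** If `G_T(·,W) ∈ 𝓗_n(ℂ)` (`T(G_W) ≪ T(F_W)`) for every `W ∈ ℋⁿ`, then `G_T(z,w) ∈ 𝓗_{2n}(ℝ)`.
[cite: BorceaBranden2009, §4 proof of Thm. 1.2 ("we may assume that `T[(z+W)^κ] ∈ 𝓗_n(ℂ)` for all
`W ∈ {Im(z) > 0}ⁿ` … But this amounts to saying that `T[(z+w)^κ] ∈ 𝓗_{2n}(ℝ)`")] -/
theorem isRealStable_realMultiAffineSymbol_of_forall
    (hb : ∀ W : σ → ℂ, (∀ i, 0 < (W i).im) → IsProperPosition (T (imProdXAddC W)) (T (reProdXAddC W))) :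
    IsRealStable (realMultiAffineSymbol T) := by
  intro zw hzw
  rw [← Sum.elim_comp_inl_inr zw, eval_map_realMultiAffineSymbol, symbolAt_eq]
  exact hb _ (fun i => hzw (Sum.inr i)) _ fun i => hzw (Sum.inl i)

/-- **`i · G_T(·, conj V) = T(G_V) + i T(F_V)`**: since `conj(V)^{[n]∖S} = conj(V^{[n]∖S})` and
`i · conj(x + iy) = y + ix`. (This identity converts "`G_T(·,W) ∈ 𝓗_n^-(ℂ)` for all `W ∈ ℋⁿ`" into
"`G_T(·,-W) ∈ 𝓗_n(ℂ)` for all `W ∈ ℋⁿ`", the form used at the end of the printed proof.)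
[cite: BorceaBranden2009, §4 proof of Thm. 1.2 ("or `T[(z-W)^κ] ∈ 𝓗_n(ℂ)` for all `W ∈ {Im(z)>0}ⁿ`")] -/
theorem C_I_mul_symbolAt_conj {W V : σ → ℂ} (hWV : ∀ i, W i = conj (V i)) :
    C Complex.I * symbolAt T W =
      map (algebraMap ℝ ℂ) (T (imProdXAddC V)) + C Complex.I * map (algebraMap ℝ ℂ) (T (reProdXAddC V)) := by
  rw [symbolAt, reProdXAddC, imProdXAddC, apply_multiAffine, apply_multiAffine, map_sum, map_sum, mul_sum,
    mul_sum, ← sum_add_distrib]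
  refine sum_congr rfl fun S _ => ?_
  rw [smul_eq_C_mul, smul_eq_C_mul, smul_eq_C_mul, map_mul, map_mul, map_C, map_C, ← mul_assoc,
    ← mul_assoc, ← add_mul, ← map_mul, ← map_mul, ← map_add]
  congr 2
  have hprod : ∏ i ∈ Sᶜ, W i = conj (∏ i ∈ Sᶜ, V i) := by
    rw [map_prod]
    exact prod_congr rfl fun i _ => hWV i
  rw [hprod]
  generalize ∏ i ∈ Sᶜ, V i = p
  apply Complex.ext <;> simp

/-- **Case (c).** If `G_T(·,W) ∈ 𝓗_n^-(ℂ)` (`T(F_W) ≪ T(G_W)`) for every `W ∈ ℋⁿ`, then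
`G_T(z,-w) ∈ 𝓗_{2n}(ℝ)`: for `z, w ∈ ℋⁿ`, `G_T(z,-w) = G_T(·, conj V)(z)` with `V = -conj w ∈ ℋⁿ`, and
`i G_T(·, conj V) = T(G_V) + iT(F_V)` is stable. [cite: BorceaBranden2009, §4 proof of Thm. 1.2 ("or
`T[(z-W)^κ] ∈ 𝓗_n(ℂ)` for all `W ∈ {Im(z)>0}ⁿ`. But this amounts to saying that … `T[(z-w)^κ] ∈ 𝓗_{2n}(ℝ)`")] -/
theorem isRealStable_negInr_realMultiAffineSymbol_of_forall
    (hc : ∀ W : σ → ℂ, (∀ i, 0 < (W i).im) → IsProperPosition (T (reProdXAddC W)) (T (imProdXAddC W))) :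
    IsRealStable (negInr (realMultiAffineSymbol T)) := by
  intro zw hzw
  rw [map_negInr, ← Sum.elim_comp_inl_inr zw, eval_negInr, eval_map_realMultiAffineSymbol]
  set V : σ → ℂ := fun i => -conj (zw (Sum.inr i)) with hV_def
  have hVim : ∀ i, 0 < (V i).im := fun i => by
    simpa [hV_def] using hzw (Sum.inr i)
  have hWV : ∀ i, (-(zw ∘ Sum.inr)) i = conj (V i) := fun i => by
    simp [hV_def]
  have hne := hc V hVim (zw ∘ Sum.inl) fun i => hzw (Sum.inl i)
  rw [← C_I_mul_symbolAt_conj T hWV, map_mul, eval_C] at hne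
  exact right_ne_zero_of_mul hne

end SymbolCases

/-! ## §4 The homotopy argument -/

section Homotopy

variable [Fintype σ] [DecidableEq σ] (T : MvPolynomial σ ℝ →ₗ[ℝ] MvPolynomial σ ℝ)

/-- `T(F_W)(z) = Σ_S Re(W^{[n]∖S}) · T(z^S)(z)` — in particular continuous (polynomial) in `W`.
[cite: BorceaBranden2009, §4 proof of Thm. 1.2 ("By a homotopy argument")] -/
theorem eval_map_apply_reProdXAddC (W z : σ → ℂ) :
    eval z (map (algebraMap ℝ ℂ) (T (reProdXAddC W))) =
      ∑ S : Finset σ, ((∏ i ∈ Sᶜ, W i).re : ℂ) * eval z (map (algebraMap ℝ ℂ) (T (∏ i ∈ S, X i))) := by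
  rw [reProdXAddC, apply_multiAffine, map_sum, map_sum]
  refine sum_congr rfl fun S _ => ?_
  rw [smul_eq_C_mul, map_mul, map_C, map_mul, eval_C, Complex.coe_algebraMap]

/-- `T(G_W)(z) = Σ_S Im(W^{[n]∖S}) · T(z^S)(z)` — in particular continuous (polynomial) in `W`.
[cite: BorceaBranden2009, §4 proof of Thm. 1.2 ("By a homotopy argument")] -/
theorem eval_map_apply_imProdXAddC (W z : σ → ℂ) :
    eval z (map (algebraMap ℝ ℂ) (T (imProdXAddC W))) =
      ∑ S : Finset σ, ((∏ i ∈ Sᶜ, W i).im : ℂ) * eval z (map (algebraMap ℝ ℂ) (T (∏ i ∈ S, X i))) := by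
  rw [imProdXAddC, apply_multiAffine, map_sum, map_sum]
  refine sum_congr rfl fun S _ => ?_
  rw [smul_eq_C_mul, map_mul, map_C, map_mul, eval_C, Complex.coe_algebraMap]

omit [Fintype σ] [DecidableEq σ] in
/-- The half-plane condition `Im (u_t(z) · conj v_t(z)) ≤ 0 on ℋⁿ` of Lemma 1.8 is closed in the parameter `t`
when `u_t(z), v_t(z)` depend continuously on `t`. [cite: BorceaBranden2009, §1.2 Lemma 1.8 and §4 proof of
Thm. 1.2 ("By a homotopy argument")] -/
theorem isClosed_setOf_im_eval_mul_conj_nonpos {u v : ℝ → MvPolynomial σ ℝ}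
    (hu : ∀ z : σ → ℂ, Continuous fun t => eval z (map (algebraMap ℝ ℂ) (u t)))
    (hv : ∀ z : σ → ℂ, Continuous fun t => eval z (map (algebraMap ℝ ℂ) (v t))) :
    IsClosed {t : ℝ | ∀ z : σ → ℂ, (∀ i, 0 < (z i).im) →
      (eval z (map (algebraMap ℝ ℂ) (u t)) * conj (eval z (map (algebraMap ℝ ℂ) (v t)))).im ≤ 0} := by
  simp only [Set.setOf_forall]
  exact isClosed_iInter fun z => isClosed_iInter fun _ =>
    isClosed_le (Complex.continuous_im.comp ((hu z).mul (Complex.continuous_conj.comp (hv z))))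
      continuous_const

omit [Fintype σ] [DecidableEq σ] in
/-- **The connectedness step**: if `[0,1]` is covered by the two closed half-plane conditions
`Im (u_t conj v_t) ≤ 0 on ℋⁿ` and `Im (v_t conj u_t) ≤ 0 on ℋⁿ`, the first holding at `t = 0` and the second at
`t = 1`, then both hold at some `t ∈ [0,1]`. [cite: BorceaBranden2009, §4 proof of Thm. 1.2 ("By a homotopy
argument we then deduce that there exists `t ∈ [0,1]` such that
`G_T(z,W') ∈ 𝓗_n(ℂ) ∩ 𝓗_n^-(ℂ) ∪ {0}`")] -/
theorem exists_mem_Icc_of_cover {u v : ℝ → MvPolynomial σ ℝ}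
    (hu : ∀ z : σ → ℂ, Continuous fun t => eval z (map (algebraMap ℝ ℂ) (u t)))
    (hv : ∀ z : σ → ℂ, Continuous fun t => eval z (map (algebraMap ℝ ℂ) (v t)))
    (hcover : ∀ t ∈ Set.Icc (0 : ℝ) 1,
      (∀ z : σ → ℂ, (∀ i, 0 < (z i).im) →
        (eval z (map (algebraMap ℝ ℂ) (u t)) * conj (eval z (map (algebraMap ℝ ℂ) (v t)))).im ≤ 0) ∨
      (∀ z : σ → ℂ, (∀ i, 0 < (z i).im) →
        (eval z (map (algebraMap ℝ ℂ) (v t)) * conj (eval z (map (algebraMap ℝ ℂ) (u t)))).im ≤ 0))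
    (h0 : ∀ z : σ → ℂ, (∀ i, 0 < (z i).im) →
      (eval z (map (algebraMap ℝ ℂ) (u 0)) * conj (eval z (map (algebraMap ℝ ℂ) (v 0)))).im ≤ 0)
    (h1 : ∀ z : σ → ℂ, (∀ i, 0 < (z i).im) →
      (eval z (map (algebraMap ℝ ℂ) (v 1)) * conj (eval z (map (algebraMap ℝ ℂ) (u 1)))).im ≤ 0) :
    ∃ t ∈ Set.Icc (0 : ℝ) 1,
      (∀ z : σ → ℂ, (∀ i, 0 < (z i).im) →
        (eval z (map (algebraMap ℝ ℂ) (u t)) * conj (eval z (map (algebraMap ℝ ℂ) (v t)))).im ≤ 0) ∧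
      (∀ z : σ → ℂ, (∀ i, 0 < (z i).im) →
        (eval z (map (algebraMap ℝ ℂ) (v t)) * conj (eval z (map (algebraMap ℝ ℂ) (u t)))).im ≤ 0) := by
  obtain ⟨t, ht, htB, htA⟩ := isPreconnected_closed_iff.1 isPreconnected_Icc _ _
    (isClosed_setOf_im_eval_mul_conj_nonpos hu hv) (isClosed_setOf_im_eval_mul_conj_nonpos hv hu)
    (fun t ht => hcover t ht) ⟨0, ⟨le_rfl, zero_le_one⟩, h0⟩ ⟨1, ⟨zero_le_one, le_rfl⟩, h1⟩
  exact ⟨t, ht, htB, htA⟩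

/-- **The homotopy step.** If `G_T(·,W₁) ∉ 𝓗_n(ℂ)` and `G_T(·,W₂) ∉ 𝓗_n^-(ℂ)` for some `W₁, W₂ ∈ ℋⁿ`, then some
`W' = (1-t)W₁ + tW₂ ∈ ℋⁿ`, `t ∈ [0,1]`, has `G_T(·,W') ∈ (𝓗_n(ℂ) ∩ 𝓗_n^-(ℂ)) ∪ {0}`.
[cite: BorceaBranden2009, §4 proof of Thm. 1.2 ("Suppose that there are `W₁, W₂ ∈ {Im(z)>0}ⁿ` such that
`G_T(z,W₁) ∈ 𝓗_n(ℂ) ∪ {0}` and `G_T(z,W₂) ∈ 𝓗_n^-(ℂ) ∪ {0}`. By a homotopy argument … there exists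
`t ∈ [0,1]` such that `G_T(z,W') ∈ 𝓗_n(ℂ) ∩ 𝓗_n^-(ℂ) ∪ {0}`, where `W' = (1-t)W₁ + tW₂`")] -/
theorem exists_degenerate
    (hT : ∀ f : MvPolynomial σ ℝ, IsMultiAffine f → IsRealStable f → IsRealStable (T f) ∨ T f = 0)
    {W₁ W₂ : σ → ℂ} (hW₁ : ∀ i, 0 < (W₁ i).im) (hW₂ : ∀ i, 0 < (W₂ i).im)
    (h₁ : ¬IsProperPosition (T (imProdXAddC W₁)) (T (reProdXAddC W₁)))
    (h₂ : ¬IsProperPosition (T (reProdXAddC W₂)) (T (imProdXAddC W₂))) :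
    ∃ W : σ → ℂ, (∀ i, 0 < (W i).im) ∧ (symbolAt T W = 0 ∨
      (IsProperPosition (T (imProdXAddC W)) (T (reProdXAddC W)) ∧
        IsProperPosition (T (reProdXAddC W)) (T (imProdXAddC W)))) := by
  -- the segment `W_t = (1-t)W₁ + tW₂`
  set Wt : ℝ → σ → ℂ := fun t i => (1 - (t : ℂ)) * W₁ i + (t : ℂ) * W₂ i with hWt
  have hmem : ∀ t ∈ Set.Icc (0 : ℝ) 1, ∀ i, 0 < (Wt t i).im := by
    intro t ht i
    have him : (Wt t i).im = (1 - t) * (W₁ i).im + t * (W₂ i).im := by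
      simp only [hWt, Complex.add_im, Complex.mul_im, Complex.sub_re, Complex.one_re, Complex.ofReal_re,
        Complex.sub_im, Complex.one_im, Complex.ofReal_im]
      ring
    rw [him]
    rcases eq_or_lt_of_le ht.1 with h0 | h0
    · rw [← h0, sub_zero, one_mul, zero_mul, add_zero]
      exact hW₁ i
    · exact add_pos_of_nonneg_of_pos (mul_nonneg (sub_nonneg.2 ht.2) (hW₁ i).le) (mul_pos h0 (hW₂ i))
  have hW0 : Wt 0 = W₁ := by
    funext i
    simp [hWt]
  have hW1 : Wt 1 = W₂ := by
    funext i
    simp [hWt]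
  have hcont : ∀ i, Continuous fun t : ℝ => Wt t i := fun i => by
    simp only [hWt]
    exact ((continuous_const.sub Complex.continuous_ofReal).mul continuous_const).add
      (Complex.continuous_ofReal.mul continuous_const)
  have hre : ∀ z : σ → ℂ, Continuous fun t : ℝ => eval z (map (algebraMap ℝ ℂ) (T (reProdXAddC (Wt t)))) := by
    intro z
    simp only [eval_map_apply_reProdXAddC]
    exact continuous_finsetSum _ fun S _ =>
      (Complex.continuous_ofReal.comp
        (Complex.continuous_re.comp (continuous_finsetProd _ fun i _ => hcont i))).mul continuous_const
  have him : ∀ z : σ → ℂ, Continuous fun t : ℝ => eval z (map (algebraMap ℝ ℂ) (T (imProdXAddC (Wt t)))) := by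
    intro z
    simp only [eval_map_apply_imProdXAddC]
    exact continuous_finsetSum _ fun S _ =>
      (Complex.continuous_ofReal.comp
        (Complex.continuous_im.comp (continuous_finsetProd _ fun i _ => hcont i))).mul continuous_const
  -- the cover of `[0,1]` by the two closed conditions, from the trichotomy
  have hcover : ∀ t ∈ Set.Icc (0 : ℝ) 1,
      (∀ z : σ → ℂ, (∀ i, 0 < (z i).im) →
        (eval z (map (algebraMap ℝ ℂ) (T (reProdXAddC (Wt t)))) *
          conj (eval z (map (algebraMap ℝ ℂ) (T (imProdXAddC (Wt t)))))).im ≤ 0) ∨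
      (∀ z : σ → ℂ, (∀ i, 0 < (z i).im) →
        (eval z (map (algebraMap ℝ ℂ) (T (imProdXAddC (Wt t)))) *
          conj (eval z (map (algebraMap ℝ ℂ) (T (reProdXAddC (Wt t)))))).im ≤ 0) := by
    intro t ht
    rcases apply_trichotomy T hT (hmem t ht) with ⟨-, hu⟩ | h | h
    · exact Or.inl fun z _ => by rw [hu, map_zero, map_zero, zero_mul, Complex.zero_im]
    · exact Or.inr fun z hz => h.im_eval_mul_conj_nonpos hz
    · exact Or.inl fun z hz => h.im_eval_mul_conj_nonpos hz
  have h0 : ∀ z : σ → ℂ, (∀ i, 0 < (z i).im) →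
      (eval z (map (algebraMap ℝ ℂ) (T (reProdXAddC (Wt 0)))) *
        conj (eval z (map (algebraMap ℝ ℂ) (T (imProdXAddC (Wt 0)))))).im ≤ 0 := by
    rw [hW0]
    rcases apply_trichotomy T hT hW₁ with ⟨-, hu⟩ | h | h
    · exact fun z _ => by rw [hu, map_zero, map_zero, zero_mul, Complex.zero_im]
    · exact absurd h h₁
    · exact fun z hz => h.im_eval_mul_conj_nonpos hz
  have h1 : ∀ z : σ → ℂ, (∀ i, 0 < (z i).im) →
      (eval z (map (algebraMap ℝ ℂ) (T (imProdXAddC (Wt 1)))) *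
        conj (eval z (map (algebraMap ℝ ℂ) (T (reProdXAddC (Wt 1)))))).im ≤ 0 := by
    rw [hW1]
    rcases apply_trichotomy T hT hW₂ with ⟨hv, -⟩ | h | h
    · exact fun z _ => by rw [hv, map_zero, map_zero, zero_mul, Complex.zero_im]
    · exact fun z hz => h.im_eval_mul_conj_nonpos hz
    · exact absurd h h₂
  obtain ⟨t₀, ht₀, htB, htA⟩ := exists_mem_Icc_of_cover (u := fun t => T (reProdXAddC (Wt t)))
    (v := fun t => T (imProdXAddC (Wt t))) hre him hcover h0 h1
  refine ⟨Wt t₀, hmem t₀ ht₀, ?_⟩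
  have hu0 := apply_reProdXAddC_eq_zero_or_isRealStable T hT (hmem t₀ ht₀)
  have hv0 := apply_imProdXAddC_eq_zero_or_isRealStable T hT (hmem t₀ ht₀)
  rcases apply_trichotomy T hT (hmem t₀ ht₀) with h | h | h
  · exact Or.inl ((symbolAt_eq_zero_iff T _).2 h)
  · exact Or.inr ⟨h, IsProperPosition.of_im_eval_mul_conj_nonpos hu0 hv0
      (fun hh => h.not_and_eq_zero ⟨hh.2, hh.1⟩) htB⟩
  · exact Or.inr ⟨IsProperPosition.of_im_eval_mul_conj_nonpos hv0 hu0
      (fun hh => h.not_and_eq_zero ⟨hh.2, hh.1⟩) htA, h⟩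

end Homotopy

/-! ## §5 Theorem 1.2 for multi-affine polynomials -/

section Main

variable [Fintype σ] [DecidableEq σ] (T : MvPolynomial σ ℝ →ₗ[ℝ] MvPolynomial σ ℝ)

/-- **Borcea–Brändén I, Theorem 1.2 for multi-affine polynomials — necessity**: if `T` maps real stable
multi-affine polynomials to real stable polynomials or `0`, then (a) `T(f) = α(f)P + β(f)Q` on multi-affine `f`
with `P, Q` real stable, `P ≪ Q`, or (b) `G_T(z,w) ∈ 𝓗_{2n}(ℝ)`, or (c) `G_T(z,-w) ∈ 𝓗_{2n}(ℝ)`.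
[cite: BorceaBranden2009, §1.1 Thm. 1.2 ("only if"), case κ = (1,…,1), and §4 (its proof)] -/
theorem multiAffine_realStabilityPreserver_necessity
    (hT : ∀ f : MvPolynomial σ ℝ, IsMultiAffine f → IsRealStable f → IsRealStable (T f) ∨ T f = 0) :
    (∃ (α β : MvPolynomial σ ℝ →ₗ[ℝ] ℝ) (P Q : MvPolynomial σ ℝ), IsRealStable P ∧ IsRealStable Q ∧
        IsProperPosition P Q ∧ ∀ f : MvPolynomial σ ℝ, IsMultiAffine f → T f = α f • P + β f • Q) ∨
      IsRealStable (realMultiAffineSymbol T) ∨ IsRealStable (negInr (realMultiAffineSymbol T)) := by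
  by_cases hb : ∀ W : σ → ℂ, (∀ i, 0 < (W i).im) →
      IsProperPosition (T (imProdXAddC W)) (T (reProdXAddC W))
  · exact Or.inr (Or.inl (isRealStable_realMultiAffineSymbol_of_forall T hb))
  by_cases hc : ∀ W : σ → ℂ, (∀ i, 0 < (W i).im) →
      IsProperPosition (T (reProdXAddC W)) (T (imProdXAddC W))
  · exact Or.inr (Or.inr (isRealStable_negInr_realMultiAffineSymbol_of_forall T hc))
  push Not at hb hc
  obtain ⟨W₁, hW₁, h₁⟩ := hb
  obtain ⟨W₂, hW₂, h₂⟩ := hc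
  obtain ⟨W, hW, hdeg⟩ := exists_degenerate T hT hW₁ hW₂ h₁ h₂
  obtain ⟨a, b, hab, h0⟩ := exists_pair_of_degenerate T hdeg
  exact Or.inl (exists_rankTwo_of_forall_apply fun h hh =>
    apply_eq_zero_or_isRealStable_of_pair T hT hW hab h0 hh)

/-- **Borcea–Brändén I, Theorem 1.2 for multi-affine polynomials (`κ = (1,…,1)`).** A linear operator `T` on
`ℝ[z_σ]` maps real stable multi-affine polynomials to real stable polynomials or `0` if and only if either
(a) `T(f) = α(f)P + β(f)Q` on multi-affine `f`, with linear functionals `α, β` and real stable `P ≪ Q`, or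
(b) `G_T(z,w) = T[(z+w)^{[n]}] ∈ 𝓗_{2n}(ℝ)`, or (c) `G_T(z,-w) ∈ 𝓗_{2n}(ℝ)`.
[cite: BorceaBranden2009, §1.1 Thm. 1.2, case κ = (1,…,1)] -/
theorem multiAffine_realStabilityPreserver_iff :
    (∀ f : MvPolynomial σ ℝ, IsMultiAffine f → IsRealStable f → IsRealStable (T f) ∨ T f = 0) ↔
      ((∃ (α β : MvPolynomial σ ℝ →ₗ[ℝ] ℝ) (P Q : MvPolynomial σ ℝ), IsRealStable P ∧ IsRealStable Q ∧
          IsProperPosition P Q ∧ ∀ f : MvPolynomial σ ℝ, IsMultiAffine f → T f = α f • P + β f • Q) ∨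
        IsRealStable (realMultiAffineSymbol T) ∨ IsRealStable (negInr (realMultiAffineSymbol T))) :=
  ⟨multiAffine_realStabilityPreserver_necessity T, fun h _ hf hs =>
    realStabilityPreserver_of_rankTwo_or_symbol T h hf hs⟩

/-- **The dimension dichotomy behind Theorem 1.2**: a real stability preserver on multi-affine polynomials
either has all its values `T(h)` (`h` multi-affine) in `𝓗_n(ℝ) ∪ {0}` — hence an image of dimension at most two,
Lemma 3.2 (i) — or one of its symbols `G_T(z,±w)` is real stable. [cite: BorceaBranden2009, §4 proof of
Thm. 1.2 ("This means that all nonzero polynomials in the image of `T` are real stable … Thus we may assume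
that `T[(z+W)^κ] ∈ 𝓗_n(ℂ)` for all `W` … or `T[(z-W)^κ] ∈ 𝓗_n(ℂ)` for all `W`")] -/
theorem forall_apply_or_symbol
    (hT : ∀ f : MvPolynomial σ ℝ, IsMultiAffine f → IsRealStable f → IsRealStable (T f) ∨ T f = 0) :
    (∀ h : MvPolynomial σ ℝ, IsMultiAffine h → T h = 0 ∨ IsRealStable (T h)) ∨
      IsRealStable (realMultiAffineSymbol T) ∨ IsRealStable (negInr (realMultiAffineSymbol T)) := by
  by_cases hb : ∀ W : σ → ℂ, (∀ i, 0 < (W i).im) →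
      IsProperPosition (T (imProdXAddC W)) (T (reProdXAddC W))
  · exact Or.inr (Or.inl (isRealStable_realMultiAffineSymbol_of_forall T hb))
  by_cases hc : ∀ W : σ → ℂ, (∀ i, 0 < (W i).im) →
      IsProperPosition (T (reProdXAddC W)) (T (imProdXAddC W))
  · exact Or.inr (Or.inr (isRealStable_negInr_realMultiAffineSymbol_of_forall T hc))
  push Not at hb hc
  obtain ⟨W₁, hW₁, h₁⟩ := hb
  obtain ⟨W₂, hW₂, h₂⟩ := hc
  obtain ⟨W, hW, hdeg⟩ := exists_degenerate T hT hW₁ hW₂ h₁ h₂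
  obtain ⟨a, b, hab, h0⟩ := exists_pair_of_degenerate T hdeg
  exact Or.inl fun h hh => apply_eq_zero_or_isRealStable_of_pair T hT hW hab h0 hh

omit [DecidableEq σ] in
/-- In case (a) the image of `T` on `ℝ_{(1,…,1)}[z_σ]` has dimension at most two (Lemma 3.2 (i)).
[cite: BorceaBranden2009, §1.1 Thm. 1.2 (a) ("`T` has range of dimension no greater than two") and §3
Lemma 3.2 (i)] -/
theorem rank_map_realMultiAffineSubmodule_le_two
    (himg : ∀ h : MvPolynomial σ ℝ, IsMultiAffine h → T h = 0 ∨ IsRealStable (T h)) :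
    Module.rank ℝ ((realMultiAffineSubmodule σ).map T) ≤ 2 :=
  rank_le_two_of_forall_mem _ fun p hp => by
    obtain ⟨f, hf, rfl⟩ := Submodule.mem_map.1 hp
    exact himg f hf

end Main

end Literature.Combinatorics.StablePolynomials

end
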